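import Summits.QuantumFields.YangMills.Theorems.LuscherReductionTwistedTraceScalingBTColourMean
import HarnessLib

/-!
# Colour disintegration of the gauge-orbit measure: `Haar^{Λ} ≅ Haar(c) ⊗ Haar^{Λ∖x₀}(k)` under `g = (x ↦ c·k_x, k_{x₀} = 1)`, and the Faddeev–Popov window factors out EXACTLY
# (tool for the log-free MOMENT analysis of the rate twin «ratepack-v3 / frozen fibres»; route `FlatTubeReduction`, crux K1 `NearFlatRatioLaw` stmt-QuantumFields-24720;
# seat `ym-line-ftr-p1` g12; R2b1 RECORD rung — no summit statement is proved here)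

WHY (memo `Cruxes/NearFlatRatioLaw/Lines/ratepack-v3-frozen-g12.md` §5.6 (iii)).  The volume growth / floor of the Gaussian level sets `{β·kinDefect ≤ t}` must resolve the
Faddeev–Popov scale `ε = β^{-1}` of the colour zero mode (RED lane A's floor at scale `β^{-1}` is what forces its `log²β` budgets).  In the coordinates `g_x = c·k_x` (`c = g_{x₀}`,
`k_{x₀} = 1`) the kinetic defect depends on `c` only through a global colour rotation of the fibre datum, the FP window is `𝟙{c·colourMean(k) ∈ fpBall ε}`
(`colourMean_constMul`), and `∫_c fpWeight ε (c·k) dc = fpZ ε` for EVERY `k` (`fpWeight_orbit`): numerator and denominator of every moment ratio carry the same factor `fpZ ε`.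
* `colourJoin x₀ (c, k)` (the one definition: `x₀ ↦ c`, `x ≠ x₀ ↦ c·k_x`), `colourJoin_apply_self`, `colourJoin_apply_ne`, `colourJoin_eq_constMul`, `measurable_colourJoin`;
* ★★ `measurePreserving_colourJoin` — `(c, k) ↦ colourJoin x₀ (c, k)` pushes `Haar ⊗ Haar^{Λ∖x₀}` to `gaugeMeasure` (Mathlib `measurePreserving_piEquivPiSubtypeProd`, `piUnique`, and the
  shear `(c, k) ↦ (c, c·k)` by `MeasurePreserving.skew_product` + left invariance);
* ★ `lintegral_gaugeMeasure_eq_colour` / `integral_gaugeMeasure_eq_colour` — `∫F dgaugeMeasure = ∫_c∫_k F(colourJoin x₀ (c,k))`;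
* ★ `integral_fpWeight_colourJoin` — `∫_c fpWeight ε (colourJoin x₀ (c, k)) dc = fpZ ε` for every `k`.
HONEST FRAMING: measure bookkeeping; femto rung R2b1 (RECORD label); not infinite volume, not a gap, not Clay.  One definition, no named facts, no `sorry`.
-/

set_option autoImplicit false

noncomputable section

open MeasureTheory Filter Topology Real Set
open scoped BigOperators ENNReal
open Literature.MathematicalPhysics.QuantumFieldTheory
open Literature.MathematicalPhysics.QuantumLattice

namespace Summit.QuantumFields.YangMills.Theorems.FemtoTransferGap.RateTube

open Summit.QuantumFields.YangMills.Theorems.FemtoTransferGap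
open Summit.QuantumFields.YangMills.Theorems.FemtoTransferGap.TwoLattice
open Summit.QuantumFields.YangMills.Theorems.FemtoTransferGap.TwoLattice.ConstTube
open Summit.QuantumFields.YangMills.Theorems.FemtoTransferGap.TwoLattice.Avg

variable {L : ℕ} [NeZero L]

/-! ## §1 The colour coordinates -/

/-- **Colour coordinates of a gauge transformation**: `colourJoin x₀ (c, k)` is the gauge transformation `x₀ ↦ c`, `x ↦ c·k_x` (`x ≠ x₀`). [folklore] -/
def colourJoin (x₀ : Site 3 L) (q : SU2 × ({x : Site 3 L // ¬x = x₀} → SU2)) : Site 3 L → SU2 :=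
  fun x => if h : x = x₀ then q.1 else q.1 * q.2 ⟨x, h⟩

omit [NeZero L] in
/-- At the base point: `colourJoin x₀ (c, k) x₀ = c`. [folklore] -/
theorem colourJoin_apply_self (x₀ : Site 3 L) (q : SU2 × ({x : Site 3 L // ¬x = x₀} → SU2)) : colourJoin x₀ q x₀ = q.1 := by
  unfold colourJoin; rw [dif_pos rfl]

omit [NeZero L] in
/-- Off the base point: `colourJoin x₀ (c, k) x = c·k_x`. [folklore] -/
theorem colourJoin_apply_ne (x₀ : Site 3 L) (q : SU2 × ({x : Site 3 L // ¬x = x₀} → SU2)) {x : Site 3 L} (h : ¬x = x₀) : colourJoin x₀ q x = q.1 * q.2 ⟨x, h⟩ := by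
  unfold colourJoin; rw [dif_neg h]

omit [NeZero L] in
/-- `colourJoin x₀ (c, k) = c · colourJoin x₀ (1, k)` (a constant colour rotation of the normalised transformation). [folklore] -/
theorem colourJoin_eq_constMul (x₀ : Site 3 L) (c : SU2) (k : {x : Site 3 L // ¬x = x₀} → SU2) : colourJoin x₀ (c, k) = fun x => c * colourJoin x₀ (1, k) x := by
  funext x
  by_cases h : x = x₀
  · subst h; rw [colourJoin_apply_self, colourJoin_apply_self, mul_one]
  · rw [colourJoin_apply_ne x₀ _ h, colourJoin_apply_ne x₀ _ h, one_mul]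

omit [NeZero L] in
/-- `colourJoin x₀` is measurable. [folklore] -/
theorem measurable_colourJoin (x₀ : Site 3 L) : Measurable (colourJoin (L := L) x₀) := by
  refine measurable_pi_lambda _ fun x => ?_
  by_cases h : x = x₀
  · simp only [colourJoin, dif_pos h]; exact measurable_fst
  · simp only [colourJoin, dif_neg h]; exact measurable_fst.mul ((measurable_pi_apply _).comp measurable_snd)

/-! ## §2 ★★ The colour coordinates preserve the measure -/

/-- ★★ **`(c, k) ↦ colourJoin x₀ (c, k)` pushes `Haar ⊗ Haar^{Λ∖x₀}` forward to `gaugeMeasure`.** [folklore] -/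
theorem measurePreserving_colourJoin (x₀ : Site 3 L) :
    MeasurePreserving (colourJoin (L := L) x₀) ((haarProbability SU2).prod (Measure.pi fun _ : {x : Site 3 L // ¬x = x₀} => haarProbability SU2)) (gaugeMeasure L) := by
  classical
  haveI : (haarProbability SU2).IsMulLeftInvariant := by unfold haarProbability; infer_instance
  haveI hU : Unique {x : Site 3 L // x = x₀} := ⟨⟨⟨x₀, rfl⟩⟩, fun y => Subtype.ext y.2⟩
  -- the three measure-preserving maps (the `convert` absorbs the two `Fintype` instances on the subtype `{x // x = x₀}`)
  have mp1 : MeasurePreserving (MeasurableEquiv.piEquivPiSubtypeProd (fun _ : Site 3 L => SU2) (fun x => x = x₀)).symm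
      ((Measure.pi fun _ : {x : Site 3 L // x = x₀} => haarProbability SU2).prod (Measure.pi fun _ : {x : Site 3 L // ¬x = x₀} => haarProbability SU2)) (gaugeMeasure L) := by
    convert (measurePreserving_piEquivPiSubtypeProd (fun _ : Site 3 L => haarProbability SU2) (fun x => x = x₀)).symm _ using 3
  have mp2 : MeasurePreserving (Prod.map (MeasurableEquiv.piUnique (fun _ : {x : Site 3 L // x = x₀} => SU2)).symm id)
      ((haarProbability SU2).prod (Measure.pi fun _ : {x : Site 3 L // ¬x = x₀} => haarProbability SU2))
      ((Measure.pi fun _ : {x : Site 3 L // x = x₀} => haarProbability SU2).prod (Measure.pi fun _ : {x : Site 3 L // ¬x = x₀} => haarProbability SU2)) := by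
    convert ((measurePreserving_piUnique (fun _ : {x : Site 3 L // x = x₀} => haarProbability SU2)).symm _).prod
      (MeasurePreserving.id (Measure.pi fun _ : {x : Site 3 L // ¬x = x₀} => haarProbability SU2)) using 3
  have mp3 : MeasurePreserving (fun q : SU2 × ({x : Site 3 L // ¬x = x₀} → SU2) => (q.1, fun x => q.1 * q.2 x))
      ((haarProbability SU2).prod (Measure.pi fun _ : {x : Site 3 L // ¬x = x₀} => haarProbability SU2))
      ((haarProbability SU2).prod (Measure.pi fun _ : {x : Site 3 L // ¬x = x₀} => haarProbability SU2)) := by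
    refine MeasurePreserving.skew_product (g := fun (c : SU2) (k : {x : Site 3 L // ¬x = x₀} → SU2) => fun x => c * k x) (MeasurePreserving.id _) ?_
      (ae_of_all _ fun c => ?_)
    · exact measurable_pi_lambda _ fun x => measurable_fst.mul ((measurable_pi_apply x).comp measurable_snd)
    · exact (measurePreserving_pi (fun _ : {x : Site 3 L // ¬x = x₀} => haarProbability SU2) (fun _ => haarProbability SU2)
        fun _ => measurePreserving_mul_left (haarProbability SU2) c).map_eq
  have hcomp : colourJoin (L := L) x₀ = (MeasurableEquiv.piEquivPiSubtypeProd (fun _ : Site 3 L => SU2) (fun x => x = x₀)).symm ∘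
      Prod.map (MeasurableEquiv.piUnique (fun _ : {x : Site 3 L // x = x₀} => SU2)).symm id ∘
        (fun q : SU2 × ({x : Site 3 L // ¬x = x₀} → SU2) => (q.1, fun x => q.1 * q.2 x)) := by
    funext q x
    simp only [Function.comp_apply, Prod.map_apply, id, MeasurableEquiv.piEquivPiSubtypeProd_symm_apply, MeasurableEquiv.piUnique_symm_apply]
    by_cases h : x = x₀
    · rw [dif_pos h, colourJoin, dif_pos h]
      have hd : (⟨x, h⟩ : {x : Site 3 L // x = x₀}) = default := Subsingleton.elim _ _
      rw [hd, uniqueElim_default]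
    · rw [dif_neg h, colourJoin, dif_neg h]
  rw [hcomp]
  exact mp1.comp (mp2.comp mp3)

/-! ## §3 ★ Disintegration formulas and the Faddeev–Popov factor -/

/-- ★ **Colour disintegration (`ℝ≥0∞` form)**: `∫⁻ F dgaugeMeasure = ∫⁻_c ∫⁻_k F(colourJoin x₀ (c, k))`. [folklore] -/
theorem lintegral_gaugeMeasure_eq_colour (x₀ : Site 3 L) {F : (Site 3 L → SU2) → ℝ≥0∞} (hF : Measurable F) :
    ∫⁻ g, F g ∂gaugeMeasure L = ∫⁻ c, ∫⁻ k, F (colourJoin x₀ (c, k)) ∂(Measure.pi fun _ : {x : Site 3 L // ¬x = x₀} => haarProbability SU2) ∂haarProbability SU2 := by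
  have hmp := measurePreserving_colourJoin (L := L) x₀
  rw [← hmp.map_eq, lintegral_map hF (measurable_colourJoin x₀)]
  exact lintegral_prod (fun q => F (colourJoin x₀ q)) (hF.comp (measurable_colourJoin x₀)).aemeasurable

/-- ★ **Colour disintegration (Bochner form)**: for `F` integrable against `gaugeMeasure`, `∫ F dgaugeMeasure = ∫_c ∫_k F(colourJoin x₀ (c, k))`. [folklore] -/
theorem integral_gaugeMeasure_eq_colour (x₀ : Site 3 L) {F : (Site 3 L → SU2) → ℝ} (hF : Integrable F (gaugeMeasure L)) :
    ∫ g, F g ∂gaugeMeasure L = ∫ c, ∫ k, F (colourJoin x₀ (c, k)) ∂(Measure.pi fun _ : {x : Site 3 L // ¬x = x₀} => haarProbability SU2) ∂haarProbability SU2 := by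
  have hmp := measurePreserving_colourJoin (L := L) x₀
  have hint : Integrable (fun q : SU2 × ({x : Site 3 L // ¬x = x₀} → SU2) => F (colourJoin x₀ q))
      ((haarProbability SU2).prod (Measure.pi fun _ : {x : Site 3 L // ¬x = x₀} => haarProbability SU2)) := hmp.integrable_comp_of_integrable hF
  have hsm : AEStronglyMeasurable F (Measure.map (colourJoin (L := L) x₀) ((haarProbability SU2).prod (Measure.pi fun _ : {x : Site 3 L // ¬x = x₀} => haarProbability SU2))) := by
    rw [hmp.map_eq]; exact hF.aestronglyMeasurable
  rw [← hmp.map_eq, integral_map (measurable_colourJoin x₀).aemeasurable hsm]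
  exact integral_prod (fun q => F (colourJoin x₀ q)) hint

/-- The integrand `(c, k) ↦ F(colourJoin x₀ (c, k))` is integrable on the product whenever `F` is integrable against `gaugeMeasure`. [folklore] -/
theorem integrable_comp_colourJoin (x₀ : Site 3 L) {F : (Site 3 L → SU2) → ℝ} (hF : Integrable F (gaugeMeasure L)) :
    Integrable (fun q : SU2 × ({x : Site 3 L // ¬x = x₀} → SU2) => F (colourJoin x₀ q))
      ((haarProbability SU2).prod (Measure.pi fun _ : {x : Site 3 L // ¬x = x₀} => haarProbability SU2)) :=
  (measurePreserving_colourJoin (L := L) x₀).integrable_comp_of_integrable hF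

/-- ★ **The Faddeev–Popov window factors out EXACTLY**: `∫_c fpWeight ε (colourJoin x₀ (c, k)) dc = fpZ ε` for every relative field `k` (lane A's `fpWeight_orbit`). [cite: Luscher1983, §3] -/
theorem integral_fpWeight_colourJoin (x₀ : Site 3 L) (ε : ℝ) (k : {x : Site 3 L // ¬x = x₀} → SU2) :
    ∫ c, fpWeight L ε (colourJoin x₀ (c, k)) ∂haarProbability SU2 = fpZ ε := by
  have h := fpWeight_orbit L ε (colourJoin x₀ (1, k))
  refine Eq.trans (integral_congr_ae (ae_of_all _ fun c => ?_)) h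
  dsimp only
  rw [colourJoin_eq_constMul x₀ c k]

end Summit.QuantumFields.YangMills.Theorems.FemtoTransferGap.RateTube

end
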